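import Summits.CriticalPhenomena.PercolationContinuityZ3.Theorems.PercNearOneGluingNoHeavyLowerTailSahiOneStepCone
import Literature.Probability.Percolation.DecisionTreeWeightedMeasure
import HarnessLib

/-!
# One-step scheme: objects of the FIBRE CRITERIA (review-queued definitions, D-0009)

Definitions file (prover prim-ineq-prove-3 gen 16; `--supports stmt-CriticalPhenomena-4575`; memo
`run/shared/lean/prim/prim-ineq-prove-3/FINDING-G16-FIBRE-MAJ5.md` §2).  Used by `…SahiOneStepFibre` (the two- and three-copy fibre criteria for the
one-step hypotheses `(3′)`, `(2′)`) and by the finite fibre certificates for threshold slots.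
* `pat X` — the set of `F`-patterns `S : Finset ι` with `↑S ∈ X`;
* `phi2 H A B S S′ = 1_{HAB}(S)(1 + 1_H(S′)) − 1_H(S)1_{AB}(S′) − 1_{HA}(S)1_{HB}(S′)` — the two-copy summand of `m′`;
* `phi3 H A B S₀ S₁ S₂ = 1_{HA}(S₁)1_{HB}(S₂) + 1_{HAB}(S₁)(1 − 1_H(S₀)) + 1_H(S₀)1_A(S₁)1_B(S₂) − 1_{HA}(S₁)1_B(S₂) − 1_A(S₁)1_{HB}(S₂)` — the
  three-copy summand of `n`;
* `wfib`, `wfib3` — the Bernoulli weight of a two- and three-copy fibre; `key3` — the fibre key of a triple of patterns.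
-/

noncomputable section

namespace Summit.CriticalPhenomena.PercolationContinuityZ3.Theorems

namespace SahiOneStep

open MeasureTheory Finset
open Literature.Probability.Percolation (DeterminedBy determinedBy_iff determinedBy_univ)
open Literature.Probability.LatticeModels (prodBernoulli)
open Literature.Probability.Percolation.DecisionTree (ind wtW PrW PrW_eq_sum_ind sum_wtW prodBernoulli_real_eq_PrW)
open scoped Classical

variable {ι : Type*} [Fintype ι] [DecidableEq ι]

/-- The set of `F`-patterns of an event: `S ↦ [↑S ∈ X]`. -/
def pat (X : Set (Set ι)) : Set (Finset ι) := {S | (↑S : Set ι) ∈ X}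

omit [Fintype ι] [DecidableEq ι] in
/-- Membership in the pattern set. -/
@[simp] theorem mem_pat {X : Set (Set ι)} {S : Finset ι} : S ∈ pat X ↔ (↑S : Set ι) ∈ X := Iff.rfl

omit [Fintype ι] [DecidableEq ι] in
/-- Patterns of an intersection. -/
theorem pat_inter (X Y : Set (Set ι)) : pat (X ∩ Y) = pat X ∩ pat Y := rfl

/-- The two-copy summand of `m′`. -/
def phi2 (H A B : Set (Set ι)) (S S' : Finset ι) : ℝ :=
  ind (pat (H ∩ A ∩ B)) S * (1 + ind (pat H) S') - ind (pat H) S * ind (pat (A ∩ B)) S' - ind (pat (H ∩ A)) S * ind (pat (H ∩ B)) S'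

/-- The weight of a fibre `(I, J)`: `∏_{i∈I} pᵢ² · ∏_{i∈J∖I} pᵢ(1−pᵢ) · ∏_{i∈F∖J} (1−pᵢ)²`, written coordinatewise. -/
def wfib (F : Finset ι) (p : ι → ℝ) (I J : Finset ι) : ℝ :=
  ∏ i ∈ F, if i ∈ I then p i * p i else if i ∈ J then p i * (1 - p i) else (1 - p i) * (1 - p i)

omit [Fintype ι] in
/-- Fibre weights are nonnegative for `p ∈ [0,1]`. [folklore] -/
theorem wfib_nonneg (F : Finset ι) {p : ι → ℝ} (hp0 : ∀ i, 0 ≤ p i) (hp1 : ∀ i, p i ≤ 1) (I J : Finset ι) : 0 ≤ wfib F p I J := by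
  unfold wfib
  refine Finset.prod_nonneg fun i _ => ?_
  have h0 := hp0 i; have h1 := sub_nonneg.2 (hp1 i)
  split_ifs
  · exact mul_nonneg h0 h0
  · exact mul_nonneg h0 h1
  · exact mul_nonneg h1 h1

/-! ## Three-copy objects -/

/-- The three-copy summand of `n`: copies `(S₀, S₁, S₂)`. -/
def phi3 (H A B : Set (Set ι)) (S₀ S₁ S₂ : Finset ι) : ℝ :=
  ind (pat (H ∩ A)) S₁ * ind (pat (H ∩ B)) S₂ + ind (pat (H ∩ A ∩ B)) S₁ * (1 - ind (pat H) S₀)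
    + ind (pat H) S₀ * ind (pat A) S₁ * ind (pat B) S₂ - ind (pat (H ∩ A)) S₁ * ind (pat B) S₂ - ind (pat A) S₁ * ind (pat (H ∩ B)) S₂

/-- The weight of a three-copy fibre `(I₃, I₂, J)` (coordinates lying in three / at least two / at least one of the copies). -/
def wfib3 (F : Finset ι) (p : ι → ℝ) (I₃ I₂ J : Finset ι) : ℝ :=
  ∏ i ∈ F, if i ∈ I₃ then p i * p i * p i else if i ∈ I₂ then p i * p i * (1 - p i)
    else if i ∈ J then p i * (1 - p i) * (1 - p i) else (1 - p i) * (1 - p i) * (1 - p i)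

omit [Fintype ι] in
/-- Three-copy fibre weights are nonnegative for `p ∈ [0,1]`. [folklore] -/
theorem wfib3_nonneg (F : Finset ι) {p : ι → ℝ} (hp0 : ∀ i, 0 ≤ p i) (hp1 : ∀ i, p i ≤ 1) (I₃ I₂ J : Finset ι) :
    0 ≤ wfib3 F p I₃ I₂ J := by
  unfold wfib3
  refine Finset.prod_nonneg fun i _ => ?_
  have h0 := hp0 i; have h1 := sub_nonneg.2 (hp1 i)
  split_ifs
  · exact mul_nonneg (mul_nonneg h0 h0) h0
  · exact mul_nonneg (mul_nonneg h0 h0) h1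
  · exact mul_nonneg (mul_nonneg h0 h1) h1
  · exact mul_nonneg (mul_nonneg h1 h1) h1

/-- The fibre key of a triple of patterns. -/
def key3 (x : Finset ι × Finset ι × Finset ι) : Finset ι × Finset ι × Finset ι :=
  (x.1 ∩ x.2.1 ∩ x.2.2, (x.1 ∩ x.2.1) ∪ (x.1 ∩ x.2.2) ∪ (x.2.1 ∩ x.2.2), x.1 ∪ x.2.1 ∪ x.2.2)

end SahiOneStep

end Summit.CriticalPhenomena.PercolationContinuityZ3.Theorems
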